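import Literature.NumberTheory.DiophantineGeometry.GenEllLCyclicHeightBound
import HarnessLib

/-!
# [GenEll] Lemma 3.7 (b) / [IUTchIV] Cor 2.2 (P4) without a bound on the `j`-conjugates: a uniform
# bound on `deg_∞` when `ht_∞ ≤ κ·deg_∞ + A`

S. Mochizuki, *Arithmetic elliptic curves in general position*, Math. J. Okayama Univ. **52** (2010),
proof of Lemma 3.7, last paragraph (p. 19) [cite: MochizukiGenEll2010, Lem 3.7 p.19], and
*Inter-universal Teichmüller theory IV*, proof of Cor. 2.2 (ii), step (P4), p. 45
[cite: Mochizuki2012, IUTchIV Cor 2.2 p.45]: "the existence of an `l`-cyclic subgroup scheme of `E_F`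
would imply that `((l−2)/24)·log(q^∀) ≤ 2·log(l) + T_K` […] hence that […] `log(q^∀)` is bounded".

In the tree (`exists_htInf_le_of_admitsLCyclic`, abc-iut-S-d4) the constant `T_K` enters only through
the archimedean bound `ht_∞ ≤ deg_∞ + log max(R,1)` supplied by `|σ(j_E)| ≤ R` (the compactly bounded
`K_V`). This proof-only file records the same argument under the WEAKER, `K_V`-free archimedean input
`ht_∞([E]) ≤ κ·deg_∞([E]) + A` (`κ ≥ 0`; e.g. `κ = 3` for the Frey–Legendre curves of abc triples,
where `h(j) ≤ 6·log c + O(1)` and `deg_∞ ≥ 2·log c − O(1)`): for primes `l` with `7(κ+1) ≤ 6l` the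
same two tree inputs — [GenEll] Lemma 3.5 over number fields (`GenEll_lemma35_general`) and Prop. 3.4
(`prop34Ineq_of_pos`) — give `(l/14 − κ/12)·deg_∞ ≤ 2·log l + O_{κ,A}(1)`, hence a bound on `deg_∞`
depending only on `κ, A`. Classical; proof-only (no definitions, no facts); no elliptic curve is
asserted to satisfy the hypotheses.
-/

noncomputable section

namespace Literature.NumberTheory.DiophantineGeometry.GenEll

open _root_.NumberField _root_.IsDedekindDomain
open scoped NumberField

/-- **Uniform bound on `deg_∞` for semistable curves with `ht_∞ ≤ κ·deg_∞ + A` and an `l`-cyclic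
subgroup scheme** ([GenEll] Lemma 3.7 (b) / [IUTchIV] Cor. 2.2 (P4) with the archimedean input in linear
form): for `κ ≥ 0` and `A` there is `B = B(κ, A)` such that for every presented semistable `E_F` with
`ht_∞([E_F]) ≤ κ·deg_∞([E_F]) + A`, every prime `l` with `7(κ+1) ≤ 6l` prime to the local heights at the
primes of multiplicative reduction, if `E_F` admits an `l`-cyclic subgroup scheme then `deg_∞([E_F]) ≤ B`.
[cite: MochizukiGenEll2010, Lem 3.7 p.19] [cite: Mochizuki2012, IUTchIV Cor 2.2 p.45] -/
theorem exists_degInf_le_of_admitsLCyclic_of_htInf_le_linear {κ : ℝ} (hκ : 0 ≤ κ) (A : ℝ) :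
    ∃ B : ℝ, ∀ (P : EllPoint) (l : ℕ), l.Prime → 7 * (κ + 1) ≤ 6 * (l : ℝ) → P.IsSemistable →
      P.htInf ≤ κ * P.degInf + A →
      (∀ v : HeightOneSpectrum (𝓞 P.F), P.W.HasMultiplicativeReductionAt v →
        ¬ ((l : ℤ) ∣ P.localHeight v)) →
      P.AdmitsLCyclic l → P.degInf ≤ B := by
  -- Prop. 3.4, last `≲`, at `ε = 1/6`; Lemma 3.5 at `ε = 1/6` (`12(1+ε) = 14`)
  obtain ⟨-, -, ⟨K₂', hK₂'⟩⟩ := prop34Ineq_of_pos (by norm_num : (0 : ℝ) < 1 / 6)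
  obtain ⟨C', hC'⟩ := GenEll_lemma35_general (1 / 6) (by norm_num)
  set K₂ : ℝ := max K₂' 0 with hK₂
  set M : ℝ := max (A / 12 + K₂ / 14 + C') 0 with hM
  refine ⟨12 * M + 28 * (κ + 1), fun P l hl hl7 hss hHA hcop hcyc => ?_⟩
  have hK₂0 : 0 ≤ K₂ := le_max_right _ _
  have hM0 : 0 ≤ M := le_max_right _ _
  have hM1 : A / 12 + K₂ / 14 + C' ≤ M := le_max_left _ _
  have hl0 : (0 : ℝ) < l := by exact_mod_cast hl.pos
  have hD0 : 0 ≤ P.degInf := P.degInf_nonneg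
  -- Prop. 3.4: `14·ht_Falt ≤ (7/6)·ht_∞ + K₂`
  have h34 : 12 * (1 + 1 / 6) * P.htFalt ≤ (1 + 1 / 6) * P.htInf + K₂ := by
    have h := hK₂' P (Set.mem_univ _)
    have hK1 : K₂' ≤ K₂ := le_max_left _ _
    linarith
  -- Lemma 3.5: `(l/14)·deg_∞ ≤ ht_Falt + 2·log l + C'`
  have hdag : (l : ℝ) / 14 * P.degInf ≤ P.htFalt + 2 * Real.log l + C' := by
    have h := hC' P l hl hss hcyc hcop
    have e : (12 * (1 + 1 / 6 : ℝ))⁻¹ * l * P.degInf = (l : ℝ) / 14 * P.degInf := by ring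
    linarith
  -- `log l ≤ l`
  have hlog : Real.log l ≤ l := (Real.log_le_sub_one_of_pos hl0).trans (by linarith)
  -- combine: `deg_∞·(6l − 7κ)/84 ≤ M + 2l`
  have hcomb : P.degInf * (6 * (l : ℝ) - 7 * κ) ≤ 84 * M + 168 * l := by
    have h1 : P.htFalt ≤ (κ * P.degInf + A) / 12 + K₂ / 14 := by nlinarith
    nlinarith
  have hpos : (0 : ℝ) < 6 * (l : ℝ) - 7 * κ := by linarith
  -- `84·M ≤ 12·M·(6l − 7κ)` and `168·l ≤ 28(κ+1)(6l − 7κ)`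
  have hA' : 84 * M ≤ 12 * M * (6 * (l : ℝ) - 7 * κ) := by nlinarith
  have hB' : 168 * (l : ℝ) ≤ 28 * (κ + 1) * (6 * (l : ℝ) - 7 * κ) := by nlinarith
  have hfin : P.degInf * (6 * (l : ℝ) - 7 * κ) ≤ (12 * M + 28 * (κ + 1)) * (6 * (l : ℝ) - 7 * κ) := by
    nlinarith
  exact le_of_mul_le_mul_right hfin hpos

/-- The case `κ = 3`, `l ≥ 5` (then `7·(3+1) = 28 ≤ 30 ≤ 6l`): the shape used for the Frey–Legendre
curves of abc triples. [cite: Mochizuki2012, IUTchIV Cor 2.2 p.45] -/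
theorem exists_degInf_le_of_admitsLCyclic_of_htInf_le_three (A : ℝ) :
    ∃ B : ℝ, ∀ (P : EllPoint) (l : ℕ), l.Prime → 5 ≤ l → P.IsSemistable →
      P.htInf ≤ 3 * P.degInf + A →
      (∀ v : HeightOneSpectrum (𝓞 P.F), P.W.HasMultiplicativeReductionAt v →
        ¬ ((l : ℤ) ∣ P.localHeight v)) →
      P.AdmitsLCyclic l → P.degInf ≤ B := by
  obtain ⟨B, hB⟩ := exists_degInf_le_of_admitsLCyclic_of_htInf_le_linear (by norm_num : (0 : ℝ) ≤ 3) A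
  refine ⟨B, fun P l hl h5 hss hHA hcop hcyc => hB P l hl ?_ hss hHA hcop hcyc⟩
  have : (5 : ℝ) ≤ l := by exact_mod_cast h5
  linarith

end Literature.NumberTheory.DiophantineGeometry.GenEll

end
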